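import Literature.MathematicalPhysics.QuantumFieldTheory.BalabanImbrieJaffe1984to88.BIJ88Sect5Statements

/-!
# `BalabanImbrieJaffe1984to88.BIJ88DirichletForms305` — T. Bałaban, J. Imbrie, A. Jaffe, *Effective action and cluster
properties of the abelian Higgs model*, Commun. Math. Phys. **114** (1988) 257–315 [BalabanImbrieJaffe1988], §5.13
*Decoupling of the Small Field Region*, p. 305: the Dirichlet forms `Δ_Γ`, the decoupling operations `a_Γ`, the
interpolated form `Δ_s`, its two BLOCK IDENTITIES, and the preservation of positivity and boundedness — DEFINED for
finite matrices over a block decomposition and PROVED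

statement-level skeleton of published theorems with citation tags; proofs where landed; nothing here is a claim about the Yang–Mills mass gap

PDF held: `paper:balaban1988-cmp114-bij-abelian-higgs-effective-action` (journal page = PDF page + 256).  Render read this
session: p. 305 = PDF 49 (`pages/original-p049-x2.png` of the p02 seat); p. 306 = PDF 50 (OCR text, equation numbers only).

**What the paper prints (p. 305, verbatim).**  *"To preserve positivity and boundedness properties of the inverse covariance,
we define our s-dependent inverse covariance by taking convex combinations of inverse covariances with Dirichlet boundary
conditions. For an arbitrary subset Γ of I we define Dirichlet forms: Δ_Γ = Σ_{i∈Γ} □_iΔ□_i + □^cΔ□^c, where □^c = ∪_{i∉Γ} □_i,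
and all operators are restricted to the subspace A^{(k)″}(Γ_{y,x}) = 0. Next we define an operation a_ΓΔ_{Γ′} = Δ_{Γ∪Γ′}, and
we define a quadratic form for s = {s_i}_{i∈I}: Δ_s = Π_{i∈I}[(1 − s_i)a_i + s_i]Δ = Σ_{Γ⊂I} Π_{i∈Γ}(1 − s_i) Π_{i∈I∖Γ} s_i Δ_Γ.
Note that by resumming the expansion above and using the fact that for i″ ≠ i or i′, or for i = i′, □_i(a_{□_{i″}}Δ)□_{i′} =
□_iΔ□_{i′}, we obtain that □_iΔ_s□_{i′} = s_is_{i′}□_iΔ□_{i′}, i′ ≠ i, □_iΔ_s□_i = □_iΔ□_i. Using the theorem on unit lattice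
operators in [6], we can invert this operator to yield an exponentially decaying covariance C_s = (−Δ_s)^{−1}."*  (Here
`{□_i}_{i∈I}` is the decomposition of `Λ₁₀^{(k)}` into elementary regions, p. 304.)

**What is reproduced here (kernel-checked, zero `sorry`, no named facts).**  A finite index type `α` of variables (print: the
sites/bonds of `Λ₁₀^{(k)}` carrying `Φ = (A^{(k)″}, φ^{(k)″})`), a finite index type `I` of elementary regions and a block map
`blk : α → I` (`□_i = blk⁻¹{i}`); `Δ` any square matrix on `α` over a commutative ring `R` (print: the quadratic form of the
Gaussian measure, already restricted to the axial subspace — reading (ii)).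
* DEFINITIONS (bodies = the printed formulas): `boxProj blk i` (the 0/1 diagonal matrix of `□_i`), `boxCompl blk Γ` (of `□^c =
  ∪_{i∉Γ}□_i`), **`dirichletForm blk Δ Γ`** `:= Σ_{i∈Γ} □_iΔ□_i + □^cΔ□^c` (= `Δ_Γ`), `weight s Γ := Π_{i∈Γ}(1 − s_i)Π_{i∈I∖Γ}s_i`,
  **`interpForm blk Δ s`** `:= Σ_{Γ⊂I} weight s Γ · Δ_Γ` (= `Δ_s`, the printed expanded form; the expansion of the operator product
  `Π_i[(1 − s_i)a_i + s_i]` into this sum is r16's `BIJ88Sect5Statements.interp_expand`, proved in any commutative ring and not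
  restated).
* `dirichletForm_apply` — the matrix entries: `(Δ_Γ)_{xy} = Δ_{xy}` if `x, y` lie in the same region or both outside `∪_{i∈Γ}□_i`,
  `0` otherwise; `dirichletForm_empty` (`Δ_∅ = Δ`), `dirichletForm_univ_apply` (`Δ_I` is block diagonal).
* **`dirichletForm_dirichletForm`** — the operation: `a_Γ Δ_{Γ′} = Δ_{Γ∪Γ′}` with `a_Γ M := M_Γ` (so the `a_i = a_{{i}}` commute and
  are idempotent: `dirichletForm_comm`, `dirichletForm_idem`).
* **`boxProj_dirichletForm_singleton_boxProj`** — *"for i″ ≠ i or i′, or for i = i′, □_i(a_{□_{i″}}Δ)□_{i′} = □_iΔ□_{i′}"*.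
* **`interpForm_apply`**, **`boxProj_interpForm_boxProj`** (`□_iΔ_s□_{i′} = s_is_{i′}□_iΔ□_{i′}`, `i′ ≠ i`) and
  **`boxProj_interpForm_boxProj_same`** (`□_iΔ_s□_i = □_iΔ□_i`) — THE TWO BLOCK IDENTITIES, PROVED (by the resummation the text
  indicates: entrywise `(Δ_Γ)_{xy} = Δ_{xy}·Π_{j∈Γ}c_j` with `c_j ∈ {0,1}`, then `Π_j((1 − s_j)c_j + s_j)` via `Finset.prod_add`).
* `interpForm_one` (`Δ_{s≡1} = Δ`), `interpForm_zero` (`Δ_{s≡0} = Δ_I`), `sum_weight` (`Σ_Γ weight = 1`), `weight_nonneg` (on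
  `[0,1]^I`) — *"convex combinations"*.
* *"To preserve positivity and boundedness"*, over `ℝ`: `quadForm_dirichletForm` (`⟨v, Δ_Γv⟩ = Σ_{i∈Γ}⟨□_iv, Δ□_iv⟩ + ⟨□^cv, Δ□^cv⟩`),
  **`quadForm_dirichletForm_ge`** ∕ `quadForm_dirichletForm_le` and **`quadForm_interpForm_ge`** ∕ `quadForm_interpForm_le` (a lower
  form bound `c‖v‖² ≤ ⟨v, Δv⟩`, resp. an upper bound `⟨v, Δv⟩ ≤ C‖v‖²`, is inherited by every `Δ_Γ` and by `Δ_s` for `s ∈ [0,1]^I`),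
  **`dirichletForm_posDef`**, **`interpForm_posDef`** (positive definiteness is inherited; apply to `−Δ` for the printed sign
  convention `C_s = (−Δ_s)^{−1}`, `dirichletForm_neg` ∕ `interpForm_neg`), hence `isUnit_det_interpForm` (`Δ_s` is invertible, so
  `C_s` exists).

**Readings (declared).**  (i) `□_i`, `□^c` are the coordinate projections of a partition of the variables (`blk`); the print's
regions are unions of lattice cubes — only the partition structure is used.  (ii) *"all operators are restricted to the subspace
A^{(k)″}(Γ_{y,x}) = 0"*: `Δ` is taken to be the form already written in coordinates of that subspace (the axial gauge fixes one
coordinate per tree bond; the restriction commutes with the block projections since `Γ_{y,x}` lies in the block of `y`) — no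
separate restriction operator is modelled.  (iii) `Δ_s` is DEFINED by the printed expanded sum; its equality with the operator
product is r16's `interp_expand` read with `a_Γ ↔ dirichletForm · Γ` (`dirichletForm_dirichletForm` supplies the multiplicativity
`a_Γa_{Γ′} = a_{Γ∪Γ′}` that reading uses).  (iv) GENERALITY: any commutative ring of coefficients for the algebra, `ℝ` for the
order statements; any finite `α`, `I`, `blk`.

**What is NOT claimed.**  The exponential decay of `C_s = (−Δ_s)^{−1}` (*"the theorem on unit lattice operators in [6]"* = [Balaban
(Higgs)₂,₃ 1983] — B4's unit-lattice theorem, not imported); the expansion formulas (5.13.3) (random-walk ∕ pairing expansion,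
p. 305–306) and (5.13.4) (polymer activities `g₁`, `g₂`), the factorization over clusters, `Λ₁₂^{(k)}`; the construction of the
elementary regions `□_i` (conditions (i)–(iv) p. 304); anything of B1–B16.  NOT summit progress; NOT continuum; NOT Clay.
Imports: r16's `BIJ88Sect5Statements` only (the file of `interp_expand`, so that the two halves of the p. 305 display live
in one import cone; the mathematics here needs Mathlib alone); no Summits import; sub-namespace `…BIJ88DirichletForms305`; modifies nothing.  Cell
`lit-balaban` Phase 2, seat p02 gen 4; row C2.Eq5.13.3-5.13.4 (owner r16), the p. 305 D-members «Δ_Γ, Δ_s, C_s» → defined +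
block identities proved ((5.13.3)/(5.13.4) themselves untouched).
-/

open scoped BigOperators Matrix
open Finset

namespace Literature.MathematicalPhysics.QuantumFieldTheory.BalabanImbrieJaffe1984to88.BIJ88DirichletForms305

variable {α I : Type*} [Fintype α] [DecidableEq α] [DecidableEq I]

section Algebra

variable {R : Type*} [CommRing R] (blk : α → I)

/-! ## The block projections `□_i`, `□^c` -/

/-- `□_i` (p. 304–305): the coordinate projection onto the variables of the elementary region `i`, as the diagonal 0/1
matrix. [cite: BalabanImbrieJaffe1988, §5.13 p.305] -/
def boxProj (i : I) : Matrix α α R := Matrix.diagonal fun x => if blk x = i then 1 else 0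

/-- `□^c = ∪_{i∉Γ} □_i` (p. 305): the coordinate projection onto the variables outside the regions of `Γ`.
[cite: BalabanImbrieJaffe1988, §5.13 p.305] -/
def boxCompl (Γ : Finset I) : Matrix α α R := Matrix.diagonal fun x => if blk x ∈ Γ then 0 else 1

/-- entries of `□_i M □_{i′}`. [cite: BalabanImbrieJaffe1988, §5.13 p.305] -/
theorem boxProj_mul_mul_boxProj_apply (M : Matrix α α R) (i i' : I) (x y : α) :
    (boxProj blk i * M * boxProj blk i' : Matrix α α R) x y = if blk x = i ∧ blk y = i' then M x y else 0 := by
  rw [boxProj, boxProj, Matrix.mul_diagonal, Matrix.diagonal_mul]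
  by_cases hx : blk x = i <;> by_cases hy : blk y = i' <;> simp [hx, hy]

/-- entries of `□^c M □^c`. [cite: BalabanImbrieJaffe1988, §5.13 p.305] -/
theorem boxCompl_mul_mul_boxCompl_apply (M : Matrix α α R) (Γ : Finset I) (x y : α) :
    (boxCompl blk Γ * M * boxCompl blk Γ : Matrix α α R) x y = if blk x ∉ Γ ∧ blk y ∉ Γ then M x y else 0 := by
  rw [boxCompl, Matrix.mul_diagonal, Matrix.diagonal_mul]
  by_cases hx : blk x ∈ Γ <;> by_cases hy : blk y ∈ Γ <;> simp [hx, hy]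

/-- `□_i v` pointwise. [cite: BalabanImbrieJaffe1988, §5.13 p.305] -/
theorem boxProj_mulVec_apply (i : I) (v : α → R) (x : α) :
    (boxProj blk i *ᵥ v) x = if blk x = i then v x else 0 := by
  rw [boxProj, Matrix.mulVec_diagonal]
  split_ifs <;> simp

/-- `□^c v` pointwise. [cite: BalabanImbrieJaffe1988, §5.13 p.305] -/
theorem boxCompl_mulVec_apply (Γ : Finset I) (v : α → R) (x : α) :
    (boxCompl blk Γ *ᵥ v) x = if blk x ∈ Γ then 0 else v x := by
  rw [boxCompl, Matrix.mulVec_diagonal]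
  split_ifs <;> simp

/-! ## The Dirichlet forms `Δ_Γ` -/

/-- **`Δ_Γ`** p. 305 [PDF 49], verbatim: *"For an arbitrary subset Γ of I we define Dirichlet forms: Δ_Γ = Σ_{i∈Γ} □_iΔ□_i + □^cΔ□^c,
where □^c = ∪_{i∉Γ} □_i"* — the regions of `Γ` decoupled from everything else, the rest left coupled.
[cite: BalabanImbrieJaffe1988, §5.13 p.305] -/
def dirichletForm (Δ : Matrix α α R) (Γ : Finset I) : Matrix α α R :=
  ∑ i ∈ Γ, boxProj blk i * Δ * boxProj blk i + boxCompl blk Γ * Δ * boxCompl blk Γ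

/-- The entries of `Δ_Γ`: `Δ_{xy}` is kept iff `x, y` lie in the same region or both lie outside `∪_{i∈Γ}□_i`.
[cite: BalabanImbrieJaffe1988, §5.13 p.305] -/
theorem dirichletForm_apply (Δ : Matrix α α R) (Γ : Finset I) (x y : α) :
    dirichletForm blk Δ Γ x y = if blk x = blk y ∨ (blk x ∉ Γ ∧ blk y ∉ Γ) then Δ x y else 0 := by
  rw [dirichletForm, Matrix.add_apply, Matrix.sum_apply, boxCompl_mul_mul_boxCompl_apply]
  simp_rw [boxProj_mul_mul_boxProj_apply]
  have hsum : (∑ i ∈ Γ, if blk x = i ∧ blk y = i then Δ x y else 0) = if blk x ∈ Γ ∧ blk x = blk y then Δ x y else 0 := by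
    have hterm : ∀ i, (if blk x = i ∧ blk y = i then Δ x y else 0) = if blk x = i then (if blk y = blk x then Δ x y else 0) else 0 := by
      intro i
      by_cases h1 : blk x = i
      · subst h1
        simp
      · rw [if_neg (fun hh => h1 hh.1), if_neg h1]
    simp_rw [hterm]
    rw [Finset.sum_ite_eq]
    by_cases h1 : blk x ∈ Γ
    · rw [if_pos h1]
      by_cases h2 : blk x = blk y
      · rw [if_pos h2.symm, if_pos ⟨h1, h2⟩]
      · rw [if_neg (fun e => h2 e.symm), if_neg (fun hh => h2 hh.2)]
    · rw [if_neg h1, if_neg (fun hh => h1 hh.1)]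
  rw [hsum]
  by_cases hxy : blk x = blk y
  · rw [← hxy]
    by_cases h1 : blk x ∈ Γ <;> simp [h1]
  · rw [if_neg (fun hh => hxy hh.2), zero_add]
    by_cases h2 : blk x ∉ Γ ∧ blk y ∉ Γ
    · rw [if_pos h2, if_pos (Or.inr h2)]
    · rw [if_neg h2, if_neg (by tauto)]

/-- `Δ_∅ = Δ` (nothing decoupled). [cite: BalabanImbrieJaffe1988, §5.13 p.305] -/
@[simp] theorem dirichletForm_empty (Δ : Matrix α α R) : dirichletForm blk Δ ∅ = Δ := by
  ext x y
  simp [dirichletForm_apply]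

/-- `Δ ↦ Δ_Γ` is compatible with negation (for the printed sign convention `C_s = (−Δ_s)^{−1}`).
[cite: BalabanImbrieJaffe1988, §5.13 p.305] -/
theorem dirichletForm_neg (Δ : Matrix α α R) (Γ : Finset I) : dirichletForm blk (-Δ) Γ = -dirichletForm blk Δ Γ := by
  ext x y
  simp only [dirichletForm_apply, Matrix.neg_apply]
  split_ifs <;> simp

/-- `Δ_Γ` is symmetric when `Δ` is: `(Δ_Γ)ᵀ = (Δᵀ)_Γ`. [cite: BalabanImbrieJaffe1988, §5.13 p.305] -/
theorem dirichletForm_transpose (Δ : Matrix α α R) (Γ : Finset I) : (dirichletForm blk Δ Γ)ᵀ = dirichletForm blk Δᵀ Γ := by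
  ext x y
  simp only [Matrix.transpose_apply, dirichletForm_apply]
  obtain h | h := eq_or_ne (blk x) (blk y)
  · simp [h]
  · simp [h, h.symm, and_comm]

/-! ## The operations `a_Γ` -/

/-- **`a_ΓΔ_{Γ′} = Δ_{Γ∪Γ′}`** p. 305, verbatim: *"Next we define an operation a_ΓΔ_{Γ′} = Δ_{Γ∪Γ′}"* — with `a_Γ M := M_Γ` this is
a THEOREM: decoupling `Γ` after `Γ′` decouples `Γ ∪ Γ′`. [cite: BalabanImbrieJaffe1988, §5.13 p.305] -/
theorem dirichletForm_dirichletForm (Δ : Matrix α α R) (Γ Γ' : Finset I) :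
    dirichletForm blk (dirichletForm blk Δ Γ') Γ = dirichletForm blk Δ (Γ ∪ Γ') := by
  ext x y
  simp only [dirichletForm_apply, Finset.mem_union, not_or]
  split_ifs <;> first | rfl | (exfalso; tauto)

/-- the operations commute: `a_Γa_{Γ′} = a_{Γ′}a_Γ`. [cite: BalabanImbrieJaffe1988, §5.13 p.305] -/
theorem dirichletForm_comm (Δ : Matrix α α R) (Γ Γ' : Finset I) :
    dirichletForm blk (dirichletForm blk Δ Γ') Γ = dirichletForm blk (dirichletForm blk Δ Γ) Γ' := by
  rw [dirichletForm_dirichletForm, dirichletForm_dirichletForm, Finset.union_comm]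

/-- … and are idempotent: `a_Γa_Γ = a_Γ`. [cite: BalabanImbrieJaffe1988, §5.13 p.305] -/
theorem dirichletForm_idem (Δ : Matrix α α R) (Γ : Finset I) :
    dirichletForm blk (dirichletForm blk Δ Γ) Γ = dirichletForm blk Δ Γ := by
  rw [dirichletForm_dirichletForm, Finset.union_idempotent]

/-- p. 305, verbatim: *"using the fact that for i″ ≠ i or i′, or for i = i′, □_i(a_{□_{i″}}Δ)□_{i′} = □_iΔ□_{i′}"* — PROVED.
[cite: BalabanImbrieJaffe1988, §5.13 p.305] -/
theorem boxProj_dirichletForm_singleton_boxProj (Δ : Matrix α α R) {i i' i'' : I} (h : (i'' ≠ i ∧ i'' ≠ i') ∨ i = i') :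
    boxProj blk i * dirichletForm blk Δ {i''} * boxProj blk i' = boxProj blk i * Δ * boxProj blk i' := by
  have hcond : i = i' ∨ (¬i = i'' ∧ ¬i' = i'') := by
    rcases h with ⟨h1, h2⟩ | h
    · exact Or.inr ⟨fun e => h1 e.symm, fun e => h2 e.symm⟩
    · exact Or.inl h
  ext x y
  rw [boxProj_mul_mul_boxProj_apply, boxProj_mul_mul_boxProj_apply, dirichletForm_apply]
  by_cases hx : blk x = i
  · by_cases hy : blk y = i'
    · simp [hx, hy, hcond]
    · simp [hy]
  · simp [hx]

/-! ## The interpolated form `Δ_s` and its block identities -/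

variable [Fintype I]

/-- the interpolation weights `Π_{i∈Γ}(1 − s_i) Π_{i∈I∖Γ} s_i` of the expansion of `Π_i[(1 − s_i)a_i + s_i]`.
[cite: BalabanImbrieJaffe1988, §5.13 p.305] -/
def weight (s : I → R) (Γ : Finset I) : R := (∏ i ∈ Γ, (1 - s i)) * ∏ i ∈ Finset.univ \ Γ, s i

/-- **`Δ_s`** p. 305 [PDF 49], verbatim: *"we define a quadratic form for s = {s_i}_{i∈I}: Δ_s = Π_{i∈I}[(1 − s_i)a_i + s_i]Δ =
Σ_{Γ⊂I} Π_{i∈Γ}(1 − s_i) Π_{i∈I∖Γ} s_i Δ_Γ"* — DEFINED by the expanded sum (the expansion of the product is r16's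
`BIJ88Sect5Statements.interp_expand`). [cite: BalabanImbrieJaffe1988, §5.13 p.305] -/
def interpForm (Δ : Matrix α α R) (s : I → R) : Matrix α α R :=
  ∑ Γ ∈ (Finset.univ : Finset I).powerset, weight s Γ • dirichletForm blk Δ Γ

/-- *"convex combinations"*: the weights sum to `1` (`Π_i((1 − s_i) + s_i) = 1`). [cite: BalabanImbrieJaffe1988, §5.13 p.305] -/
theorem sum_weight (s : I → R) : ∑ Γ ∈ (Finset.univ : Finset I).powerset, weight s Γ = 1 := by
  have h := Finset.prod_add (fun i => 1 - s i) s (Finset.univ : Finset I)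
  simp only [sub_add_cancel, Finset.prod_const_one] at h
  unfold weight
  exact h.symm

/-- **The entries of `Δ_s`** (the resummation p. 305): `(Δ_s)_{xy} = Δ_{xy}` if `x, y` lie in the same region, and
`= s_{i}s_{i′}Δ_{xy}` if `x ∈ □_i`, `y ∈ □_{i′}`, `i ≠ i′`. [cite: BalabanImbrieJaffe1988, §5.13 p.305] -/
theorem interpForm_apply (Δ : Matrix α α R) (s : I → R) (x y : α) :
    interpForm blk Δ s x y = if blk x = blk y then Δ x y else s (blk x) * s (blk y) * Δ x y := by
  -- the 0/1 coefficients c_j with (Δ_Γ)_{xy} = (Π_{j∈Γ} c_j) Δ_{xy}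
  set c : I → R := fun j => if blk x ≠ blk y ∧ (j = blk x ∨ j = blk y) then 0 else 1 with hc
  have hA : ∀ Γ : Finset I, dirichletForm blk Δ Γ x y = (∏ j ∈ Γ, c j) * Δ x y := by
    intro Γ
    rw [dirichletForm_apply]
    by_cases hxy : blk x = blk y
    · have h1 : ∏ j ∈ Γ, c j = 1 := Finset.prod_eq_one fun j _ => by simp [hc, hxy]
      rw [h1, one_mul, if_pos (Or.inl hxy)]
    · by_cases hΓ : blk x ∈ Γ ∨ blk y ∈ Γ
      · have h0 : ∏ j ∈ Γ, c j = 0 := by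
          rcases hΓ with h | h
          · exact Finset.prod_eq_zero h (by simp [hc, hxy])
          · exact Finset.prod_eq_zero h (by simp [hc, hxy])
        rw [h0, zero_mul, if_neg (by tauto)]
      · push Not at hΓ
        have h1 : ∏ j ∈ Γ, c j = 1 := Finset.prod_eq_one fun j hj => by
          have hjx : j ≠ blk x := fun e => hΓ.1 (e ▸ hj)
          have hjy : j ≠ blk y := fun e => hΓ.2 (e ▸ hj)
          simp [hc, hjx, hjy]
        rw [h1, one_mul, if_pos (Or.inr hΓ)]
  -- resummation: Σ_Γ weight·Π_{Γ} c = Π_j ((1 − s_j)c_j + s_j)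
  have hB : interpForm blk Δ s x y = (∏ j, ((1 - s j) * c j + s j)) * Δ x y := by
    rw [interpForm, Matrix.sum_apply]
    simp_rw [Matrix.smul_apply, smul_eq_mul, hA, weight]
    rw [Finset.prod_add, Finset.sum_mul]
    refine Finset.sum_congr rfl fun Γ _ => ?_
    rw [Finset.prod_mul_distrib]
    ring
  have hC : ∏ j, ((1 - s j) * c j + s j) = if blk x = blk y then 1 else s (blk x) * s (blk y) := by
    by_cases hxy : blk x = blk y
    · rw [if_pos hxy]
      exact Finset.prod_eq_one fun j _ => by simp [hc, hxy]
    · rw [if_neg hxy, Finset.prod_eq_mul (blk x) (blk y) hxy (fun j _ hj => by simp [hc, hj.1, hj.2])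
        (fun hh => absurd (Finset.mem_univ _) hh) (fun hh => absurd (Finset.mem_univ _) hh)]
      simp [hc, hxy]
  rw [hB, hC]
  split_ifs <;> ring

/-- **Block identity, off-diagonal** p. 305, verbatim: *"we obtain that □_iΔ_s□_{i′} = s_is_{i′}□_iΔ□_{i′}, i′ ≠ i"* — PROVED.
[cite: BalabanImbrieJaffe1988, §5.13 p.305] -/
theorem boxProj_interpForm_boxProj (Δ : Matrix α α R) (s : I → R) {i i' : I} (h : i ≠ i') :
    boxProj blk i * interpForm blk Δ s * boxProj blk i' = (s i * s i') • (boxProj blk i * Δ * boxProj blk i') := by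
  ext x y
  rw [boxProj_mul_mul_boxProj_apply, Matrix.smul_apply, boxProj_mul_mul_boxProj_apply, interpForm_apply, smul_eq_mul]
  by_cases hx : blk x = i
  · by_cases hy : blk y = i'
    · simp [hx, hy, h]
    · simp [hy]
  · simp [hx]

/-- **Block identity, diagonal** p. 305, verbatim: *"□_iΔ_s□_i = □_iΔ□_i"* — PROVED. [cite: BalabanImbrieJaffe1988, §5.13 p.305] -/
theorem boxProj_interpForm_boxProj_same (Δ : Matrix α α R) (s : I → R) (i : I) :
    boxProj blk i * interpForm blk Δ s * boxProj blk i = boxProj blk i * Δ * boxProj blk i := by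
  ext x y
  rw [boxProj_mul_mul_boxProj_apply, boxProj_mul_mul_boxProj_apply, interpForm_apply]
  by_cases hx : blk x = i
  · by_cases hy : blk y = i
    · simp [hx, hy]
    · simp [hy]
  · simp [hx]

/-- `Δ_{s≡1} = Δ` (fully coupled: the `t = 1` end of the interpolation). [cite: BalabanImbrieJaffe1988, §5.13 p.305] -/
theorem interpForm_one (Δ : Matrix α α R) : interpForm blk Δ (fun _ => 1) = Δ := by
  ext x y
  simp [interpForm_apply]

/-- `Δ_I` is block diagonal (everything decoupled). [cite: BalabanImbrieJaffe1988, §5.13 p.305] -/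
theorem dirichletForm_univ_apply (Δ : Matrix α α R) (x y : α) :
    dirichletForm blk Δ Finset.univ x y = if blk x = blk y then Δ x y else 0 := by
  simp [dirichletForm_apply]

/-- `Δ_{s≡0} = Δ_I` (all regions decoupled). [cite: BalabanImbrieJaffe1988, §5.13 p.305] -/
theorem interpForm_zero (Δ : Matrix α α R) : interpForm blk Δ (fun _ => 0) = dirichletForm blk Δ Finset.univ := by
  ext x y
  rw [interpForm_apply, dirichletForm_univ_apply]
  split_ifs <;> simp

/-- `Δ ↦ Δ_s` is compatible with negation. [cite: BalabanImbrieJaffe1988, §5.13 p.305] -/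
theorem interpForm_neg (Δ : Matrix α α R) (s : I → R) : interpForm blk (-Δ) s = -interpForm blk Δ s := by
  ext x y
  simp only [interpForm_apply, Matrix.neg_apply]
  split_ifs <;> ring

/-- `Δ_s` is symmetric when `Δ` is: `(Δ_s)ᵀ = (Δᵀ)_s`. [cite: BalabanImbrieJaffe1988, §5.13 p.305] -/
theorem interpForm_transpose (Δ : Matrix α α R) (s : I → R) : (interpForm blk Δ s)ᵀ = interpForm blk Δᵀ s := by
  ext x y
  simp only [Matrix.transpose_apply, interpForm_apply]
  obtain h | h := eq_or_ne (blk x) (blk y)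
  · simp [h]
  · rw [if_neg h.symm, if_neg h, mul_comm (s (blk y))]

end Algebra

/-! ## "To preserve positivity and boundedness properties of the inverse covariance" (p. 305) -/

section Order

variable (blk : α → I)

/-- The block projections resolve the identity in `ℓ²`: `Σ_{i∈Γ}‖□_iv‖² + ‖□^cv‖² = ‖v‖²`. [cite: BalabanImbrieJaffe1988, §5.13 p.305] -/
theorem sum_sq_boxProj (Γ : Finset I) (v : α → ℝ) :
    ∑ i ∈ Γ, (boxProj blk i *ᵥ v) ⬝ᵥ (boxProj blk i *ᵥ v) + (boxCompl blk Γ *ᵥ v) ⬝ᵥ (boxCompl blk Γ *ᵥ v) = v ⬝ᵥ v := by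
  simp only [dotProduct, boxProj_mulVec_apply, boxCompl_mulVec_apply]
  rw [Finset.sum_comm, ← Finset.sum_add_distrib]
  refine Finset.sum_congr rfl fun x _ => ?_
  have hterm : ∀ i, (if blk x = i then v x else 0) * (if blk x = i then v x else 0) = if blk x = i then v x * v x else 0 := by
    intro i
    split_ifs <;> simp
  simp_rw [hterm]
  rw [Finset.sum_ite_eq]
  split_ifs <;> simp

/-- The quadratic form of `Δ_Γ`: `⟨v, Δ_Γv⟩ = Σ_{i∈Γ}⟨□_iv, Δ□_iv⟩ + ⟨□^cv, Δ□^cv⟩`. [cite: BalabanImbrieJaffe1988, §5.13 p.305] -/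
theorem quadForm_dirichletForm (Δ : Matrix α α ℝ) (Γ : Finset I) (v : α → ℝ) :
    v ⬝ᵥ (dirichletForm blk Δ Γ *ᵥ v) =
      ∑ i ∈ Γ, (boxProj blk i *ᵥ v) ⬝ᵥ (Δ *ᵥ (boxProj blk i *ᵥ v)) +
        (boxCompl blk Γ *ᵥ v) ⬝ᵥ (Δ *ᵥ (boxCompl blk Γ *ᵥ v)) := by
  have hP : ∀ (d : α → ℝ) (w : α → ℝ), w ᵥ* Matrix.diagonal d = Matrix.diagonal d *ᵥ w := fun d w => by
    ext x
    rw [Matrix.vecMul_diagonal, Matrix.mulVec_diagonal, mul_comm]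
  have hsand : ∀ d : α → ℝ, v ⬝ᵥ ((Matrix.diagonal d * Δ * Matrix.diagonal d) *ᵥ v) =
      (Matrix.diagonal d *ᵥ v) ⬝ᵥ (Δ *ᵥ (Matrix.diagonal d *ᵥ v)) := fun d => by
    rw [← Matrix.mulVec_mulVec, ← Matrix.mulVec_mulVec, Matrix.dotProduct_mulVec, hP]
  rw [dirichletForm, Matrix.add_mulVec, Matrix.sum_mulVec, dotProduct_add, dotProduct_sum]
  simp only [boxProj, boxCompl, hsand]

/-- **Positivity preserved**: a lower form bound `c‖v‖² ≤ ⟨v, Δv⟩` of `Δ` is inherited by every Dirichlet form `Δ_Γ`.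
[cite: BalabanImbrieJaffe1988, §5.13 p.305] -/
theorem quadForm_dirichletForm_ge {Δ : Matrix α α ℝ} {c : ℝ} (hΔ : ∀ v, c * (v ⬝ᵥ v) ≤ v ⬝ᵥ (Δ *ᵥ v)) (Γ : Finset I)
    (v : α → ℝ) : c * (v ⬝ᵥ v) ≤ v ⬝ᵥ (dirichletForm blk Δ Γ *ᵥ v) := by
  rw [quadForm_dirichletForm, ← sum_sq_boxProj blk Γ v, mul_add, Finset.mul_sum]
  exact add_le_add (Finset.sum_le_sum fun i _ => hΔ _) (hΔ _)

/-- **Boundedness preserved**: an upper form bound `⟨v, Δv⟩ ≤ C‖v‖²` of `Δ` is inherited by every `Δ_Γ`.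
[cite: BalabanImbrieJaffe1988, §5.13 p.305] -/
theorem quadForm_dirichletForm_le {Δ : Matrix α α ℝ} {C : ℝ} (hΔ : ∀ v, v ⬝ᵥ (Δ *ᵥ v) ≤ C * (v ⬝ᵥ v)) (Γ : Finset I)
    (v : α → ℝ) : v ⬝ᵥ (dirichletForm blk Δ Γ *ᵥ v) ≤ C * (v ⬝ᵥ v) := by
  rw [quadForm_dirichletForm, ← sum_sq_boxProj blk Γ v, mul_add, Finset.mul_sum]
  exact add_le_add (Finset.sum_le_sum fun i _ => hΔ _) (hΔ _)

/-- **Positive definiteness is inherited by every `Δ_Γ`.** [cite: BalabanImbrieJaffe1988, §5.13 p.305] -/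
theorem dirichletForm_posDef {Δ : Matrix α α ℝ} (hΔ : Δ.PosDef) (Γ : Finset I) : (dirichletForm blk Δ Γ).PosDef := by
  have hH : Δᵀ = Δ := by
    have h := hΔ.isHermitian
    rw [Matrix.IsHermitian, Matrix.conjTranspose_eq_transpose_of_trivial] at h
    exact h
  refine Matrix.posDef_iff_dotProduct_mulVec.mpr ⟨?_, fun v hv => ?_⟩
  · rw [Matrix.IsHermitian, Matrix.conjTranspose_eq_transpose_of_trivial, dirichletForm_transpose, hH]
  · have hnn : ∀ w : α → ℝ, 0 ≤ w ⬝ᵥ (Δ *ᵥ w) := fun w => by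
      simpa using hΔ.posSemidef.dotProduct_mulVec_nonneg w
    have hpos : ∀ w : α → ℝ, w ≠ 0 → 0 < w ⬝ᵥ (Δ *ᵥ w) := fun w hw => by
      simpa using hΔ.dotProduct_mulVec_pos hw
    rw [star_trivial, quadForm_dirichletForm]
    obtain ⟨x, hx⟩ : ∃ x, v x ≠ 0 := by
      by_contra hcon
      push Not at hcon
      exact hv (funext hcon)
    by_cases hΓ : blk x ∈ Γ
    · have hne : boxProj blk (blk x) *ᵥ v ≠ 0 := fun h0 => by
        have := congr_fun h0 x
        rw [boxProj_mulVec_apply, if_pos rfl] at this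
        exact hx this
      exact add_pos_of_pos_of_nonneg
        (lt_of_lt_of_le (hpos _ hne) (Finset.single_le_sum (fun i _ => hnn (boxProj blk i *ᵥ v)) hΓ)) (hnn _)
    · have hne : boxCompl blk Γ *ᵥ v ≠ 0 := fun h0 => by
        have := congr_fun h0 x
        rw [boxCompl_mulVec_apply, if_neg hΓ] at this
        exact hx this
      exact add_pos_of_nonneg_of_pos (Finset.sum_nonneg fun i _ => hnn _) (hpos _ hne)

variable [Fintype I]

/-- The quadratic form of `Δ_s` is the convex combination of those of the `Δ_Γ`. [cite: BalabanImbrieJaffe1988, §5.13 p.305] -/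
theorem quadForm_interpForm (Δ : Matrix α α ℝ) (s : I → ℝ) (v : α → ℝ) :
    v ⬝ᵥ (interpForm blk Δ s *ᵥ v) =
      ∑ Γ ∈ (Finset.univ : Finset I).powerset, weight s Γ * (v ⬝ᵥ (dirichletForm blk Δ Γ *ᵥ v)) := by
  rw [interpForm, Matrix.sum_mulVec, dotProduct_sum]
  refine Finset.sum_congr rfl fun Γ _ => ?_
  rw [Matrix.smul_mulVec, dotProduct_smul, smul_eq_mul]

/-- On the cube `s ∈ [0,1]^I` the weights are nonnegative (a genuine convex combination). [cite: BalabanImbrieJaffe1988, §5.13 p.305] -/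
theorem weight_nonneg {s : I → ℝ} (hs : ∀ i, 0 ≤ s i ∧ s i ≤ 1) (Γ : Finset I) : 0 ≤ weight s Γ :=
  mul_nonneg (Finset.prod_nonneg fun i _ => sub_nonneg.2 (hs i).2) (Finset.prod_nonneg fun i _ => (hs i).1)

/-- **Positivity preserved by the interpolation**: for `s ∈ [0,1]^I` a lower form bound `c‖v‖² ≤ ⟨v, Δv⟩` is inherited by `Δ_s`
(*"we define our s-dependent inverse covariance by taking convex combinations of inverse covariances with Dirichlet boundary
conditions"*). [cite: BalabanImbrieJaffe1988, §5.13 p.305] -/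
theorem quadForm_interpForm_ge {Δ : Matrix α α ℝ} {c : ℝ} (hΔ : ∀ v, c * (v ⬝ᵥ v) ≤ v ⬝ᵥ (Δ *ᵥ v)) {s : I → ℝ}
    (hs : ∀ i, 0 ≤ s i ∧ s i ≤ 1) (v : α → ℝ) : c * (v ⬝ᵥ v) ≤ v ⬝ᵥ (interpForm blk Δ s *ᵥ v) := by
  rw [quadForm_interpForm]
  calc c * (v ⬝ᵥ v) = ∑ Γ ∈ (Finset.univ : Finset I).powerset, weight s Γ * (c * (v ⬝ᵥ v)) := by
        rw [← Finset.sum_mul, sum_weight, one_mul]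
    _ ≤ _ := Finset.sum_le_sum fun Γ _ =>
        mul_le_mul_of_nonneg_left (quadForm_dirichletForm_ge blk hΔ Γ v) (weight_nonneg hs Γ)

/-- **Boundedness preserved by the interpolation**: for `s ∈ [0,1]^I` an upper form bound is inherited by `Δ_s`.
[cite: BalabanImbrieJaffe1988, §5.13 p.305] -/
theorem quadForm_interpForm_le {Δ : Matrix α α ℝ} {C : ℝ} (hΔ : ∀ v, v ⬝ᵥ (Δ *ᵥ v) ≤ C * (v ⬝ᵥ v)) {s : I → ℝ}
    (hs : ∀ i, 0 ≤ s i ∧ s i ≤ 1) (v : α → ℝ) : v ⬝ᵥ (interpForm blk Δ s *ᵥ v) ≤ C * (v ⬝ᵥ v) := by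
  rw [quadForm_interpForm]
  calc _ ≤ ∑ Γ ∈ (Finset.univ : Finset I).powerset, weight s Γ * (C * (v ⬝ᵥ v)) := Finset.sum_le_sum fun Γ _ =>
        mul_le_mul_of_nonneg_left (quadForm_dirichletForm_le blk hΔ Γ v) (weight_nonneg hs Γ)
    _ = C * (v ⬝ᵥ v) := by rw [← Finset.sum_mul, sum_weight, one_mul]

/-- **Positive definiteness is inherited by `Δ_s`** for `s ∈ [0,1]^I` (so `C_s = Δ_s^{−1}` — printed `(−Δ_s)^{−1}` for the
opposite sign convention — exists). [cite: BalabanImbrieJaffe1988, §5.13 p.305] -/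
theorem interpForm_posDef {Δ : Matrix α α ℝ} (hΔ : Δ.PosDef) {s : I → ℝ} (hs : ∀ i, 0 ≤ s i ∧ s i ≤ 1) :
    (interpForm blk Δ s).PosDef := by
  have hH : Δᵀ = Δ := by
    have h := hΔ.isHermitian
    rw [Matrix.IsHermitian, Matrix.conjTranspose_eq_transpose_of_trivial] at h
    exact h
  refine Matrix.posDef_iff_dotProduct_mulVec.mpr ⟨?_, fun v hv => ?_⟩
  · rw [Matrix.IsHermitian, Matrix.conjTranspose_eq_transpose_of_trivial, interpForm_transpose, hH]
  · rw [star_trivial, quadForm_interpForm]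
    have hq : ∀ Γ : Finset I, 0 < v ⬝ᵥ (dirichletForm blk Δ Γ *ᵥ v) := fun Γ => by
      simpa using (dirichletForm_posDef blk hΔ Γ).dotProduct_mulVec_pos hv
    obtain ⟨Γ₀, hΓ₀, hw⟩ : ∃ Γ ∈ (Finset.univ : Finset I).powerset, 0 < weight s Γ := by
      by_contra hcon
      push Not at hcon
      have h0 : ∑ Γ ∈ (Finset.univ : Finset I).powerset, weight s Γ ≤ 0 := Finset.sum_nonpos hcon
      rw [sum_weight] at h0
      exact absurd h0 (by norm_num)
    exact lt_of_lt_of_le (mul_pos hw (hq Γ₀))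
      (Finset.single_le_sum (fun Γ _ => mul_nonneg (weight_nonneg hs Γ) (hq Γ).le) hΓ₀)

/-- … hence `Δ_s` is invertible for `s ∈ [0,1]^I` (the covariance `C_s` of p. 305 exists; its exponential DECAY is [6]'s theorem and
is not claimed). [cite: BalabanImbrieJaffe1988, §5.13 p.305] -/
theorem isUnit_det_interpForm {Δ : Matrix α α ℝ} (hΔ : Δ.PosDef) {s : I → ℝ} (hs : ∀ i, 0 ≤ s i ∧ s i ≤ 1) :
    IsUnit (interpForm blk Δ s).det :=
  isUnit_iff_ne_zero.mpr (interpForm_posDef blk hΔ hs).det_pos.ne'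

end Order

/-! ## Non-vacuity -/

section Examples

/-- Two variables in two one-point regions (`blk = id` on `Fin 2`), `Δ` the all-ones matrix, `s ≡ ½`: the off-diagonal entry
of `Δ_s` is `s₀s₁ = ¼` and the diagonal entry is untouched, as the block identities say. -/
example : interpForm (R := ℚ) (id : Fin 2 → Fin 2) (Matrix.of fun _ _ => (1 : ℚ)) (fun _ => 1 / 2) 0 1 = 1 / 4 ∧
    interpForm (R := ℚ) (id : Fin 2 → Fin 2) (Matrix.of fun _ _ => (1 : ℚ)) (fun _ => 1 / 2) 0 0 = 1 := by
  refine ⟨?_, ?_⟩ <;> rw [interpForm_apply] <;> norm_num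

end Examples

end Literature.MathematicalPhysics.QuantumFieldTheory.BalabanImbrieJaffe1984to88.BIJ88DirichletForms305
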